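import Literature.MathematicalPhysics.QuantumFieldTheory.FiniteTemperatureAbelianCentreDomination
import Literature.Probability.LatticeModels.CharacterComplexRotationBound
import Literature.Probability.LatticeModels.TorusTwoPointDecay
import Literature.MathematicalPhysics.QuantumLattice.HubbardBondPairDecaySharp
import HarnessLib

/-!
# `U(1)` lattice gauge theory at finite temperature in `2 + 1` dimensions: McBryan–Spencer
# power-law decay of the Polyakov-loop correlation at every temperature — no Polyakov long-range order

Companion of `Z2FiniteTemperatureDeconfinementD2.lean` (where the PLANAR `ℤ₂` theory is shown to
have Polyakov long-range order at every temporal extent). On Borgs–Seiler's finite-temperature lattice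
`ℤ_{L₀} × (ℤ/L)²` (`Literature.Barriers.QuantumFields.FiniteTemperatureDeconfinement`: time-like
coupling `J_E`, space-like coupling `J_M`, Polyakov-loop two-point function
`G_L(x) = polyakovCorrelation ρ J_E J_M x`), for the gauge group `U(1)` in its defining representation
(`u1Rep`), we PROVE

* `u1_abs_polyakovCorrelation_le_rpow_dim2`: for `L ≥ 3`, `J_E > 0`, `J_M ≥ 0`, every `L₀ ≥ 1` and
  every `x ∈ (ℤ/L)²`,
  `|G_L(x; J_E, J_M)| ≤ K(J_E, L₀) · 5^f · (dist(0,x) + 1)^{−f}`,  `f = L₀/(2π J_E)`,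
  `K = exp(J_E L₀ (2πq² + 76q² + 544q⁴e^{2q²}))`, `q = 1/(2πJ_E)`, `dist` the periodic `ℓ^∞` distance
  — UNIFORMLY in the volume `L` and in the magnetic coupling `J_M`;
* `u1_abs_thermodynamicLimit_le_rpow_dim2`: every thermodynamic limit `G∞` obeys
  `|G∞(x)| ≤ K · 5^f · (‖x‖_∞ + 1)^{−f}` on `ℤ²`;
* `u1_polyakovConfinementAtAllCouplings_dim2`: **`PolyakovConfinementAtAllCouplings 2 L₀ u1Rep` for
  EVERY temporal extent `L₀`** — in `2 + 1` dimensions the `U(1)` Polyakov loops NEVER have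
  long-range order (`u1_not_hasPolyakovLongRangeOrder_dim2`), at any temperature and any couplings;
  equivalently `u1_temperatureBlindPolyakovConfinement_dim2 : TemperatureBlindPolyakovConfinement 2 u1Rep`:
  the barrier file's technique class (i), refuted there for `U(N)`/`SU(N)` in `d ≥ 3` and for `ℤ₂`
  in every `d ≥ 2` (`z2_not_temperatureBlindPolyakovConfinement_of_two_le`), HOLDS for `U(1)` in
  `d = 2` — the restriction "three or more space dimensions" of the Borgs–Seiler deconfinement
  theorem [BorgsSeiler1983, Abstract; §III] cannot be lifted for the continuous abelian group `U(1)`.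
* `unitaryGroup_polyakovConfinementAtAllCouplings_dim2` /
  `unitaryGroup_temperatureBlindPolyakovConfinement_dim2` (§6): the same for the fundamental Polyakov
  loops of **`U(N)`, every `N ≥ 1`**, by the tree's abelian-centre domination `U(N) ⊇ U(1)`
  (`unitaryGroup_abs_polyakovCorrelation_le_u1`, Fröhlich 1979 / Grosse 1988 (4.134)) — with the
  explicit power law `unitaryGroup_abs_polyakovCorrelation_le_rpow_dim2` (exponent `L₀/(2πNJ_E)`,
  prefactor `N²`); for `U(N)` the Borgs–Seiler hypothesis `d ≥ 3` is thus necessary as well as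
  sufficient (`not_temperatureBlindPolyakovConfinement_unitary_holds`).

Mechanism: the `U(1)` finite-temperature theory is a Ginibre system in the plaquette characters
(`ThermalCentre.expectation_charRep_eq_ginibreExpect`); the McBryan–Spencer complex rotation of the
tree (`abs_complexGinibreExpect_reMulChar_le`: any compact abelian group, many-body characters,
complex couplings) applied to the rotation of ALL time-like links by a spatial potential `φ`,
`θ_{(t,y),0} ↦ θ_{(t,y),0} + iφ(y)`: the Polyakov pair character gains `e^{−L₀(φ(0) − φ(x))}`, only
the time-like plaquettes are charged, by the gradient `φ(y) − φ(y + e_j)`, whence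
(`u1_abs_polyakovCorrelation_le_exp_cosh_dim2`)

  `|G_L(x)| ≤ e^{−L₀(φ(0) − φ(x))} · exp(J_E L₀ Σ_{y,j} (cosh(φ(y) − φ(y+e_j)) − 1))`   for every `φ`,

i.e. the a-priori bound of the planar rotator with charge `c = L₀` and cost `b = J_E L₀/2` per ordered
adjacent pair; the tree's Euclidean truncated logarithmic dipole on the torus
(`le_rpow_euclid_of_apriori_flat`, `HubbardBondPairDecaySharp.lean`, written for Koma–Tasaki and
reused for the plane rotator in `PlaneRotatorPowerLawDecay.lean`) turns it into the power law with the
spin-wave exponent `f = 2cq − 4πbq² = L₀/(2πJ_E)` at `q = 1/(2πJ_E)`.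

HONEST LABEL. An elementary application of McBryan–Spencer's bound [McBryanSpencer1977] (for gauge
fields: Glimm–Jaffe [GlimmJaffe1977QuarkTrapping]) to the time-like links; Borgs–Seiler prove
deconfinement "at nonzero temperature in three or more space dimensions" [BorgsSeiler1983, Abstract]
and remark that the reduction of symmetry by the random couplings "certainly would be relevant for
`d = 2`" [BorgsSeiler1983, §IV p. 358]; this file records that for `U(1)` the restriction to `d ≥ 3`
is necessary. Not located in print as a separately stated theorem (presearch 2026-08-28: corpus
hybrid/vector "finite temperature U(1) lattice gauge theory two space dimensions Polyakov loop power
law McBryan–Spencer" → Montvay–Münster p. 163, Greensite ch. 8, Kapusta–Gale p. 163 (physics, no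
theorem); galaxy "Polyakov loop|McBryan-Spencer|finite temperature U(1)" → Grignani–Semenoff–Sodano,
Phys. Rev. D 53 (1996) 7157 (physics of the BKT transition of `QED₃` at finite temperature)).
"Confinement" below means ONLY Borgs–Seiler's criterion (II.23) with the rate dropped — absence of
Polyakov long-range order, `G∞(x) → 0` — which is what technique class (i) asserts; it is NOT an area
law or a linear static potential: the high-temperature phase of compact `U(1)` in `2 + 1` dimensions is
expected (Svetitsky–Yaffe; Grignani–Semenoff–Sodano) to be a Kosterlitz–Thouless phase with power-law
Polyakov correlations and a logarithmic static potential, consistent with (and not excluded by) the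
power-law upper bound proved here. An abelian, `2+1`-dimensional statement about the LATTICE theory at
fixed `L₀`; nothing here bears on `SU(N)`, on `d = 3 + 1`, on `BalabanLadder.IR`, or on the Yang–Mills
mass gap (Clay), which is NOT proved; in the `ym` ladder only the conditional finite-`𝕋⁴` rung
`BalabanLadder.UV` is closed.

## References

* O. A. McBryan, T. Spencer, Comm. Math. Phys. 53 (1977) 299–302. [McBryanSpencer1977]
* J. Glimm, A. Jaffe, Phys. Lett. 66B (1977) 67–69. [GlimmJaffe1977QuarkTrapping]
* C. Borgs, E. Seiler, Commun. Math. Phys. 91 (1983) 329–380, Abstract; §II.3 (II.22)–(II.23) p. 337;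
  §IV p. 358. [BorgsSeiler1983]
* S. Friedli, Y. Velenik, *Statistical Mechanics of Lattice Systems*, CUP 2017, Thm. 9.12. [FriedliVelenik2017]
* T. Koma, H. Tasaki, Phys. Rev. Lett. 68 (1992) 3248, eqs. (12)–(13) (the torus dipole). [KomaTasakiPRL1992]
* H. Grosse, *Models in Statistical Physics and Quantum Field Theory*, Springer 1988, §4.2.4
  eq. (4.134). [Grosse1988]
-/

noncomputable section

open MeasureTheory Filter Finset Complex
open scoped Topology BigOperators
open Literature.Probability.LatticeModels Literature.MathematicalPhysics.QuantumLattice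
open Literature.Barriers.QuantumFields Literature.Barriers.QuantumFields.FiniteTemperature

namespace Literature.MathematicalPhysics.QuantumFieldTheory

namespace U1Thermal

open Z2Thermal (PlaqIdx cpl polyakovLine_eq_prod)
open ThermalCentre (plaqChars plaqChar pairChar lineChar idxPlaq expectation_charRep_eq_ginibreExpect
  polyakovCorrelation_charRep_eq)

variable {L₀ L : ℕ}

/-! ### 1. Real couplings are complex couplings: the `U(1)` theory as a complex Ginibre system -/

/-- Ginibre's weight with real couplings is the complex-coupling weight with the same (real) couplings.
[cite: McBryanSpencer1977, proof of the main theorem (set-up)] -/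
theorem ginibreWeight_eq_complexGinibreWeight {Ω : Type*} [CommGroup Ω] [TopologicalSpace Ω]
    {ι : Type*} [Fintype ι] (χ : ι → Ω →ₜ* Circle) (J : ι → ℝ) (θ : Ω) :
    ginibreWeight χ J θ = complexGinibreWeight χ (fun a => (J a : ℂ)) θ := by
  unfold ginibreWeight complexGinibreWeight ginibreHamiltonian complexHamiltonian reChar
  refine congrArg Real.exp (Finset.sum_congr rfl fun a _ => ?_)
  rw [Complex.re_ofReal_mul]

/-- Ginibre expectations with real couplings are complex-coupling expectations.
[cite: McBryanSpencer1977, proof of the main theorem (set-up)] -/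
theorem ginibreExpect_eq_complexGinibreExpect {Ω : Type*} [CommGroup Ω] [TopologicalSpace Ω]
    [MeasurableSpace Ω] (μ : Measure Ω) {ι : Type*} [Fintype ι] (χ : ι → Ω →ₜ* Circle) (J : ι → ℝ)
    (F : Ω → ℝ) :
    ginibreExpect μ χ J F = complexGinibreExpect μ χ (fun a => (J a : ℂ)) F := by
  unfold ginibreExpect complexGinibreExpect
  simp_rw [ginibreWeight_eq_complexGinibreWeight]

/-- **The `U(1)` finite-temperature Polyakov correlation is a complex-Ginibre expectation of the pair
character** `Re(1 · χ_x)` with the real couplings `(J_E, J_M)`. [cite: BorgsSeiler1983, §II.3 (II.22) (p. 337)] -/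
theorem polyakovCorrelation_eq_complexGinibreExpect [NeZero L₀] [NeZero L] (JE JM : ℝ)
    (x : Fin 2 → ZMod L) :
    polyakovCorrelation (d := 2) (L₀ := L₀) u1Rep JE JM x =
      complexGinibreExpect (haar 2 L₀ L Circle) (plaqChars 2 L₀ L (ContinuousMonoidHom.id Circle))
        (fun a => (cpl JE JM a : ℂ))
        (fun σ => ((1 : ℂ) * ((pairChar (L₀ := L₀) (ContinuousMonoidHom.id Circle) x σ : Circle) : ℂ)).re) := by
  rw [← charRep_id_circle, polyakovCorrelation_charRep_eq, expectation_charRep_eq_ginibreExpect,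
    ginibreExpect_eq_complexGinibreExpect]
  congr 1
  funext σ
  rw [one_mul]
  rfl

/-! ### 2. The rotation of the time-like links by a spatial potential

The rotation field is `a((t,y), time) = φ(y)`, `a(·, space) = 0`, written inline as
`fun e => e.2.elim (φ e.1.2) (fun _ => 0)`; the plaquette charges are the gradients
`φ(y) − φ(y + e_j)` on time-like plaquettes and `0` on space-like ones, written inline as
`Sum.elim (fun q => φ q.1.2 − φ (q.1.2 + e_{q.2})) (fun _ => 0)`. -/

/-- Powers of `Circle.exp` are exponentials of multiples. [folklore] -/
private theorem circleExp_pow (r : ℝ) (n : ℕ) : Circle.exp r ^ n = Circle.exp (n * r) := by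
  induction n with
  | zero => simp
  | succ n ih => rw [pow_succ, ih, ← Circle.exp_add]; congr 1; push_cast; ring

/-- Plaquettes of an exponential field: `(e^{iτa})_P = e^{iτ (da)_P}`. [folklore] -/
private theorem plaquette_expField (a : FiniteTemperature.Site 2 L₀ L × Dir 2 → ℝ) (τ : ℝ)
    (s : FiniteTemperature.Site 2 L₀ L) (μ ν : Dir 2) :
    plaquette (expField a τ) s μ ν =
      Circle.exp (τ * (a (s, μ) + a (s.shift μ, ν) - a (s.shift ν, μ) - a (s, ν))) := by
  simp only [plaquette, expField_apply, ← Circle.exp_neg, ← Circle.exp_add]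
  congr 1; ring

/-- **Plaquette characters along the rotation**: `χ_P(γ_τ) = e^{iτ (dφ)_P}` — the gradient of `φ`
on time-like plaquettes, `1` on space-like plaquettes.
[cite: GlimmJaffe1977QuarkTrapping, main estimate (the rotation field)] -/
theorem plaqChars_expField (φ : (Fin 2 → ZMod L) → ℝ) (a : PlaqIdx 2 L₀ L) (τ : ℝ) :
    plaqChars 2 L₀ L (ContinuousMonoidHom.id Circle) a
        (expField (fun e : FiniteTemperature.Site 2 L₀ L × Dir 2 => e.2.elim (φ e.1.2) fun _ => 0) τ) =
      Circle.exp (τ * Sum.elim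
        (fun q : FiniteTemperature.Site 2 L₀ L × Fin 2 => φ q.1.2 - φ (q.1.2 + Pi.single q.2 1))
        (fun _ => 0) a) := by
  have hid : ∀ z, ContinuousMonoidHom.id Circle z = z := fun _ => rfl
  rcases a with ⟨s, j⟩ | ⟨s, p⟩
  · simp only [plaqChars, idxPlaq, Sum.elim_inl, ThermalCentre.plaqChar_apply, hid,
      plaquette_expField, FiniteTemperature.Site.shift, Option.elim_none, Option.elim_some]
    congr 1; ring
  · simp only [plaqChars, idxPlaq, Sum.elim_inr, ThermalCentre.plaqChar_apply, hid,
      plaquette_expField, FiniteTemperature.Site.shift, Option.elim_some]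
    congr 1; ring

/-- Along the rotation the Polyakov line is `e^{iτ L₀ φ(y)}`. [folklore] -/
private theorem polyakovLine_expField [NeZero L₀] (φ : (Fin 2 → ZMod L) → ℝ) (y : Fin 2 → ZMod L)
    (τ : ℝ) :
    polyakovLine (expField
        (fun e : FiniteTemperature.Site 2 L₀ L × Dir 2 => e.2.elim (φ e.1.2) fun _ => 0) τ) y =
      Circle.exp (τ * (L₀ * φ y)) := by
  rw [polyakovLine_eq_prod]
  simp only [expField_apply, Option.elim_none]
  rw [Finset.prod_const, Finset.card_univ, ZMod.card, circleExp_pow]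
  congr 1; ring

/-- **The Polyakov pair character along the rotation**: `χ_x(γ_τ) = e^{iτ L₀ (φ(0) − φ(x))}` — the
observable gains the charge `L₀(φ(0) − φ(x))`.
[cite: McBryanSpencer1977, proof of the main theorem (the observed character)] -/
theorem pairChar_expField [NeZero L₀] (φ : (Fin 2 → ZMod L) → ℝ) (x : Fin 2 → ZMod L) (τ : ℝ) :
    pairChar (L₀ := L₀) (ContinuousMonoidHom.id Circle) x (expField
        (fun e : FiniteTemperature.Site 2 L₀ L × Dir 2 => e.2.elim (φ e.1.2) fun _ => 0) τ) =
      Circle.exp (τ * (L₀ * (φ 0 - φ x))) := by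
  have hid : ∀ z, ContinuousMonoidHom.id Circle z = z := fun _ => rfl
  change lineChar (ContinuousMonoidHom.id Circle) 0 _ *
    (lineChar (ContinuousMonoidHom.id Circle) x _)⁻¹ = _
  simp only [ThermalCentre.lineChar_apply, hid, polyakovLine_expField, ← Circle.exp_neg,
    ← Circle.exp_add]
  congr 1; ring

/-! ### 3. The a-priori bound: McBryan–Spencer for the time-like links -/

/-- The cost of the rotation: only time-like plaquettes are charged, each of the `L₀` time slices
contributing the planar bond sum `J_E Σ_{y,j} (cosh(φ(y) − φ(y+e_j)) − 1)`.
[cite: McBryanSpencer1977, proof of the main theorem (the cost Σ (cosh − 1))] -/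
theorem sum_cost_eq [NeZero L₀] [NeZero L] {JE JM : ℝ} (hJE : 0 ≤ JE) (hJM : 0 ≤ JM)
    (φ : (Fin 2 → ZMod L) → ℝ) :
    ∑ a : PlaqIdx 2 L₀ L, ‖((cpl JE JM a : ℝ) : ℂ)‖ * (Real.cosh (Sum.elim
        (fun q : FiniteTemperature.Site 2 L₀ L × Fin 2 => φ q.1.2 - φ (q.1.2 + Pi.single q.2 1))
        (fun _ => 0) a) - 1) =
      JE * L₀ * ∑ y : (Fin 2 → ZMod L), ∑ j : Fin 2, (Real.cosh (φ y - φ (y + Pi.single j 1)) - 1) := by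
  rw [Fintype.sum_sum_type]
  simp only [cpl, Sum.elim_inl, Sum.elim_inr, Complex.norm_real, Real.norm_eq_abs,
    abs_of_nonneg hJE, abs_of_nonneg hJM, Real.cosh_zero, sub_self, mul_zero, Finset.sum_const_zero,
    add_zero]
  simp only [Fintype.sum_prod_type, Finset.sum_const, Finset.card_univ, ZMod.card, nsmul_eq_mul,
    Finset.mul_sum]
  refine Finset.sum_congr rfl fun y _ => Finset.sum_congr rfl fun j _ => ?_
  ring

/-- **McBryan–Spencer a-priori bound for the finite-temperature `U(1)` Polyakov correlation in
`2 + 1` dimensions.** For `L₀ ≥ 1`, `L ≥ 1`, `J_E, J_M ≥ 0`, every spatial potential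
`φ : (ℤ/L)² → ℝ` and every `x`:
`|G_L(x; J_E, J_M)| ≤ e^{−L₀(φ(0) − φ(x))} · exp(J_E L₀ Σ_{y,j} (cosh(φ(y) − φ(y+e_j)) − 1))`
(rotation of all time-like links by `iφ`; the space-like plaquettes are uncharged, so the bound is
uniform in `J_M`). [cite: McBryanSpencer1977, main theorem (a-priori bound before optimising the rotation)]
[cite: GlimmJaffe1977QuarkTrapping, main estimate (the rotation field)] -/
theorem u1_abs_polyakovCorrelation_le_exp_cosh_dim2 [NeZero L₀] [NeZero L] {JE JM : ℝ} (hJE : 0 ≤ JE)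
    (hJM : 0 ≤ JM) (φ : (Fin 2 → ZMod L) → ℝ) (x : Fin 2 → ZMod L) :
    |polyakovCorrelation (d := 2) (L₀ := L₀) u1Rep JE JM x| ≤
      Real.exp (-(L₀ * (φ 0 - φ x))) *
        Real.exp (JE * L₀ * ∑ y : (Fin 2 → ZMod L), ∑ j : Fin 2,
          (Real.cosh (φ y - φ (y + Pi.single j 1)) - 1)) := by
  haveI : (haarProbability Circle).IsMulRightInvariant := by
    dsimp [haarProbability]; infer_instance
  haveI : (haar 2 L₀ L Circle).IsMulRightInvariant := by unfold haar; infer_instance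
  rw [polyakovCorrelation_eq_complexGinibreExpect]
  have h := abs_complexGinibreExpect_reMulChar_le (μ := haar 2 L₀ L Circle)
    (χ := plaqChars 2 L₀ L (ContinuousMonoidHom.id Circle)) (K := fun a => ((cpl JE JM a : ℝ) : ℂ))
    (χ₀ := pairChar (L₀ := L₀) (ContinuousMonoidHom.id Circle) x)
    (q := Sum.elim
      (fun q : FiniteTemperature.Site 2 L₀ L × Fin 2 => φ q.1.2 - φ (q.1.2 + Pi.single q.2 1))
      (fun _ => 0))
    (q₀ := L₀ * (φ 0 - φ x))
    (γ := expField (fun e : FiniteTemperature.Site 2 L₀ L × Dir 2 => e.2.elim (φ e.1.2) fun _ => 0))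
    (fun a τ => plaqChars_expField φ a τ) (fun τ => pairChar_expField φ x τ) 1
  rw [norm_one, one_mul, sum_cost_eq hJE hJM] at h
  exact h

/-- For `L ≥ 3`, the neighbours of `x` in the torus graph are the `2d` distinct points `x ± eᵢ`:
`Σ_{y ∼ x} g(y) = Σᵢ (g(x + eᵢ) + g(x − eᵢ))` (the tree's `sum_ite_torusGraph_adj'`, re-proved to
avoid a heavy import, as in `PlaneRotatorPowerLawDecay.lean`). [folklore] -/
private theorem sum_ite_torusGraph_adj_real {d : ℕ} [NeZero L] (hL : 3 ≤ L) (x : TorusSite d L)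
    (g : TorusSite d L → ℝ) :
    (∑ y, if (torusGraph d L).Adj x y then g y else 0) =
      ∑ i, (g (x + Pi.single i 1) + g (x - Pi.single i 1)) := by
  classical
  haveI : Fact (1 < L) := ⟨by omega⟩
  have h1 : (1 : ZMod L) ≠ 0 := one_ne_zero
  have h2 : (1 : ZMod L) + 1 ≠ 0 := by
    intro h
    have : ((2 : ℕ) : ZMod L) = 0 := by exact_mod_cast (by simpa [one_add_one_eq_two] using h)
    rw [ZMod.natCast_eq_zero_iff] at this
    exact absurd (Nat.le_of_dvd two_pos this) (by omega)
  have hsingle_ne : ∀ i : Fin d, (Pi.single i 1 : TorusSite d L) ≠ 0 := fun i h => by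
    have := congrFun h i; simp [h1] at this
  have hsingle_inj : ∀ i j : Fin d, (Pi.single i 1 : TorusSite d L) = Pi.single j 1 → i = j := by
    intro i j h
    by_contra hij
    have := congrFun h i
    simp [hij, h1] at this
  have hsum_ne : ∀ i j : Fin d, (Pi.single i 1 : TorusSite d L) + Pi.single j 1 ≠ 0 := by
    intro i j h
    have := congrFun h i
    by_cases hij : i = j
    · subst hij; simp [h2] at this
    · simp [Ne.symm hij, h1] at this
  set Np : Finset (TorusSite d L) := univ.image fun i => x + Pi.single i 1 with hNp
  set Nm : Finset (TorusSite d L) := univ.image fun i => x - Pi.single i 1 with hNm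
  have hadj : ∀ y, (torusGraph d L).Adj x y ↔ y ∈ Np ∪ Nm := by
    intro y
    rw [torusGraph_adj_iff, Finset.mem_union, Finset.mem_image, Finset.mem_image]
    constructor
    · rintro ⟨-, ⟨i, hi⟩ | ⟨i, hi⟩⟩
      · exact Or.inl ⟨i, mem_univ _, hi.symm⟩
      · exact Or.inr ⟨i, mem_univ _, by rw [hi, add_sub_cancel_right]⟩
    · rintro (⟨i, -, hi⟩ | ⟨i, -, hi⟩)
      · refine ⟨fun hxy => hsingle_ne i ?_, Or.inl ⟨i, hi.symm⟩⟩
        have := hi; rw [← hxy] at this; simpa using this.symm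
      · refine ⟨fun hxy => hsingle_ne i ?_, Or.inr ⟨i, by rw [← hi, sub_add_cancel]⟩⟩
        have := hi; rw [← hxy, sub_eq_self] at this; exact this
  have hdisj : Disjoint Np Nm := by
    rw [Finset.disjoint_left]
    intro y hp hm
    rw [hNp, Finset.mem_image] at hp
    rw [hNm, Finset.mem_image] at hm
    obtain ⟨i, -, rfl⟩ := hp
    obtain ⟨j, -, hj⟩ := hm
    apply hsum_ne i j
    have := hj
    rw [sub_eq_iff_eq_add, add_assoc, left_eq_add] at this
    exact this
  have hinjp : Set.InjOn (fun i : Fin d => x + Pi.single i 1) (univ : Finset (Fin d)) :=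
    fun i _ j _ h => hsingle_inj i j (add_left_cancel h)
  have hinjm : Set.InjOn (fun i : Fin d => x - Pi.single i 1) (univ : Finset (Fin d)) :=
    fun i _ j _ h => hsingle_inj i j (sub_right_injective h)
  calc (∑ y, if (torusGraph d L).Adj x y then g y else 0)
      = ∑ y, if y ∈ Np ∪ Nm then g y else 0 := by
        refine Finset.sum_congr rfl fun y _ => ?_
        simp only [hadj]
    _ = ∑ y ∈ Np ∪ Nm, g y := by rw [Finset.sum_ite_mem, Finset.univ_inter]
    _ = ∑ y ∈ Np, g y + ∑ y ∈ Nm, g y := Finset.sum_union hdisj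
    _ = ∑ i, g (x + Pi.single i 1) + ∑ i, g (x - Pi.single i 1) := by
        rw [hNp, hNm, Finset.sum_image hinjp, Finset.sum_image hinjm]
    _ = ∑ i, (g (x + Pi.single i 1) + g (x - Pi.single i 1)) := (Finset.sum_add_distrib).symm

/-- **Ordered adjacent pairs are twice the directed bonds `(x, x + eᵢ)`** (`L ≥ 3`, symmetric kernel):
`Σ_x Σ_{y ∼ x} F(x,y) = 2 Σ_x Σᵢ F(x, x + eᵢ)` (as in `PlaneRotatorPowerLawDecay.lean`). [folklore] -/
private theorem sum_sum_ite_torusGraph_adj_real {d : ℕ} [NeZero L] (hL : 3 ≤ L)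
    (F : TorusSite d L → TorusSite d L → ℝ) (hF : ∀ x y, F x y = F y x) :
    (∑ x, ∑ y, if (torusGraph d L).Adj x y then F x y else 0) =
      2 * ∑ x : TorusSite d L, ∑ i : Fin d, F x (x + Pi.single i 1) := by
  have hkey : ∀ x : TorusSite d L, (∑ y, if (torusGraph d L).Adj x y then F x y else 0) =
      ∑ i, (F x (x + Pi.single i 1) + F x (x - Pi.single i 1)) := fun x =>
    sum_ite_torusGraph_adj_real hL x (F x)
  simp_rw [hkey, sum_add_distrib]
  rw [two_mul]
  congr 1
  rw [sum_comm]
  conv_rhs => rw [sum_comm]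
  refine sum_congr rfl fun i _ => ?_
  refine (Fintype.sum_equiv (Equiv.addRight (Pi.single i (1 : ZMod L)))
    (fun x => F x (x + Pi.single i 1)) (fun x => F x (x - Pi.single i 1)) fun x => ?_).symm
  simp only [Equiv.coe_addRight, add_sub_cancel_right]
  exact hF _ _

/-- The a-priori bound in the GRAPH form consumed by the torus dipole engine
(`le_rpow_euclid_of_apriori_flat`): charge `c = L₀`, cost `b = J_E L₀ / 2` per ordered adjacent
pair of the torus graph (`L ≥ 3`: each bond `{y, y + e_j}` is two ordered pairs).
[cite: McBryanSpencer1977, main theorem (a-priori bound before optimising the rotation)] -/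
theorem u1_abs_polyakovCorrelation_le_exp_cosh_adj_dim2 [NeZero L₀] [NeZero L] (hL : 3 ≤ L)
    {JE JM : ℝ} (hJE : 0 ≤ JE) (hJM : 0 ≤ JM) (φ : TorusSite 2 L → ℝ) (x : TorusSite 2 L) :
    |polyakovCorrelation (d := 2) (L₀ := L₀) u1Rep JE JM x| ≤
      Real.exp (-((L₀ : ℝ) * (φ 0 - φ x))) *
        Real.exp (JE * L₀ / 2 * ∑ u : TorusSite 2 L, ∑ v : TorusSite 2 L,
          (if (torusGraph 2 L).Adj u v then (Real.cosh (φ u - φ v) - 1) else 0)) := by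
  have h := u1_abs_polyakovCorrelation_le_exp_cosh_dim2 (L₀ := L₀) hJE hJM φ x
  rw [sum_sum_ite_torusGraph_adj_real hL (fun u v => Real.cosh (φ u - φ v) - 1)
    (fun u v => by rw [← Real.cosh_neg, neg_sub])]
  convert h using 3
  ring

/-! ### 4. The power law, uniformly in the volume -/

/-- **McBryan–Spencer power-law decay of the `U(1)` Polyakov correlation in `2 + 1` dimensions,
general charge**: for `L ≥ 3`, `J_E, J_M ≥ 0`, `q ≥ 0` with `f = L₀(2q − 2πJ_E q²) ≥ 0`,
`|G_L(x)| ≤ exp(J_E L₀ (2πq² + 76q² + 544q⁴e^{2q²})) · 5^f · (dist(0,x) + 1)^{−f}`, uniformly in `L`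
and `J_M`. [cite: McBryanSpencer1977, main theorem] [cite: KomaTasakiPRL1992, eqs. (12)–(13) (the torus dipole)] -/
theorem u1_abs_polyakovCorrelation_le_rpow_dim2_of_charge [NeZero L₀] [NeZero L] (hL : 3 ≤ L)
    {JE JM q f : ℝ} (hJE : 0 ≤ JE) (hJM : 0 ≤ JM) (hq : 0 ≤ q)
    (hfq : f = 2 * L₀ * q - 4 * Real.pi * (JE * L₀ / 2) * q ^ 2) (hf : 0 ≤ f) (x : TorusSite 2 L) :
    |polyakovCorrelation (d := 2) (L₀ := L₀) u1Rep JE JM x| ≤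
      Real.exp (JE * L₀ * (2 * Real.pi * q ^ 2 + 76 * q ^ 2 + 544 * q ^ 4 * Real.exp (2 * q ^ 2))) *
        ((5 : ℝ) ^ f * ((torusDist (0 : TorusSite 2 L) x : ℝ) + 1) ^ (-f)) := by
  have h := le_rpow_euclid_of_apriori_flat L (JE * L₀ / 2) L₀ q _ f (by positivity) hq 0 x
    (fun φ _ _ => u1_abs_polyakovCorrelation_le_exp_cosh_adj_dim2 hL hJE hJM φ x) hfq hf
  convert h using 3
  ring

/-- **McBryan–Spencer power-law decay of the `U(1)` Polyakov correlation in `2 + 1` dimensions,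
spin-wave exponent**: for `L ≥ 3`, `J_E > 0`, `J_M ≥ 0`, every `L₀ ≥ 1` and every `x ∈ (ℤ/L)²`,
`|G_L(x; J_E, J_M)| ≤ K(J_E, L₀) · 5^{L₀/(2πJ_E)} · (dist(0,x) + 1)^{−L₀/(2πJ_E)}`,
`K = exp(J_E L₀ (2πq² + 76q² + 544q⁴e^{2q²}))`, `q = 1/(2πJ_E)`, uniformly in the volume and in
`J_M`: at temperature `1/L₀` the Polyakov loops of planar compact `U(1)` are never long-range ordered.
[cite: McBryanSpencer1977, main theorem] [cite: BorgsSeiler1983, §II.3 (II.22)–(II.23) (p. 337)] -/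
theorem u1_abs_polyakovCorrelation_le_rpow_dim2 [NeZero L₀] [NeZero L] (hL : 3 ≤ L) {JE JM : ℝ}
    (hJE : 0 < JE) (hJM : 0 ≤ JM) (x : TorusSite 2 L) :
    |polyakovCorrelation (d := 2) (L₀ := L₀) u1Rep JE JM x| ≤
      Real.exp (JE * L₀ * (2 * Real.pi * (1 / (2 * Real.pi * JE)) ^ 2 +
          76 * (1 / (2 * Real.pi * JE)) ^ 2 +
          544 * (1 / (2 * Real.pi * JE)) ^ 4 * Real.exp (2 * (1 / (2 * Real.pi * JE)) ^ 2))) *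
        ((5 : ℝ) ^ ((L₀ : ℝ) / (2 * Real.pi * JE)) *
          ((torusDist (0 : TorusSite 2 L) x : ℝ) + 1) ^ (-((L₀ : ℝ) / (2 * Real.pi * JE)))) := by
  have hπ := Real.pi_pos
  have hq : (0 : ℝ) ≤ 1 / (2 * Real.pi * JE) := by positivity
  have hfq : (L₀ : ℝ) / (2 * Real.pi * JE) =
      2 * L₀ * (1 / (2 * Real.pi * JE)) - 4 * Real.pi * (JE * L₀ / 2) * (1 / (2 * Real.pi * JE)) ^ 2 := by
    field_simp
    ring
  exact u1_abs_polyakovCorrelation_le_rpow_dim2_of_charge hL hJE.le hJM hq hfq (by positivity) x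

/-! ### 5. Thermodynamic limits: no Polyakov long-range order, at any temperature -/

/-- **Every thermodynamic limit of the planar `U(1)` Polyakov correlation decays at least as a power
law**: `|G∞(x)| ≤ K(J_E, L₀) · 5^f · (‖x‖_∞ + 1)^{−f}`, `f = L₀/(2πJ_E)`, for `J_E > 0`, `J_M ≥ 0`.
[cite: McBryanSpencer1977, main theorem] [cite: BorgsSeiler1983, §II.3 (II.23) (p. 337)] -/
theorem u1_abs_thermodynamicLimit_le_rpow_dim2 (L₀ : ℕ) [NeZero L₀] {JE JM : ℝ} (hJE : 0 < JE)
    (hJM : 0 ≤ JM) {Ginf : (Fin 2 → ℤ) → ℝ}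
    (hG : IsThermodynamicLimit (d := 2) (L₀ := L₀) u1Rep JE JM Ginf) (x : Fin 2 → ℤ) :
    |Ginf x| ≤
      Real.exp (JE * L₀ * (2 * Real.pi * (1 / (2 * Real.pi * JE)) ^ 2 +
          76 * (1 / (2 * Real.pi * JE)) ^ 2 +
          544 * (1 / (2 * Real.pi * JE)) ^ 4 * Real.exp (2 * (1 / (2 * Real.pi * JE)) ^ 2))) *
        ((5 : ℝ) ^ ((L₀ : ℝ) / (2 * Real.pi * JE)) *
          ((Site.supNorm x : ℝ) + 1) ^ (-((L₀ : ℝ) / (2 * Real.pi * JE)))) := by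
  obtain ⟨ψ, hψ, hlim⟩ := hG
  have hev : ∀ᶠ n : ℕ in atTop, Site.supNorm x + 1 ≤ ψ n :=
    eventually_atTop.2 ⟨Site.supNorm x + 1, fun n hn => hn.trans (hψ.id_le n)⟩
  refine le_of_tendsto ((continuous_abs.tendsto _).comp (hlim x)) ?_
  filter_upwards [hev] with n hn
  haveI : NeZero (2 * ψ n + 2) := ⟨by omega⟩
  have hdist : torusDist (0 : TorusSite 2 (2 * ψ n + 2)) (Torus.proj (2 * ψ n + 2) x) =
      Site.supNorm x := by
    rw [torusDist_comm_holds (0 : TorusSite 2 (2 * ψ n + 2)), torusDist, sub_zero]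
    exact torusNorm_proj_eq (by omega)
  have h := u1_abs_polyakovCorrelation_le_rpow_dim2 (L₀ := L₀) (L := 2 * ψ n + 2) (by omega) hJE hJM
    (Torus.proj (2 * ψ n + 2) x)
  rw [hdist] at h
  exact h

/-- `‖x‖_∞ + 1 → ∞` along the cofinite filter of `ℤ²` (finitely many sites in each box). [folklore] -/
private theorem tendsto_supNorm_add_one_cofinite :
    Tendsto (fun x : Fin 2 → ℤ => (Site.supNorm x : ℝ) + 1) cofinite atTop := by
  refine tendsto_atTop_add_const_right _ 1 (tendsto_natCast_atTop_atTop.comp ?_)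
  rw [tendsto_atTop]
  intro M
  rw [Filter.eventually_cofinite]
  refine (Finset.finite_toSet (box 2 M)).subset fun x hx => ?_
  simp only [Set.mem_setOf_eq, not_le] at hx
  rw [Finset.mem_coe, mem_box]
  intro i
  have h1 := Site.natAbs_le_supNorm x i
  have h3 : |x i| ≤ (M : ℤ) := by
    rw [Int.abs_eq_natAbs]
    exact_mod_cast h1.trans hx.le
  exact abs_le.1 h3

/-- **`U(1)` lattice gauge theory in `2 + 1` dimensions satisfies Polyakov's criterion at EVERY
temporal extent and ALL couplings**: every thermodynamic limit of the Polyakov correlation tends to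
`0` at spatial infinity — `PolyakovConfinementAtAllCouplings 2 L₀ u1Rep` (Borgs–Seiler's criterion
(II.23) with the rate dropped: absence of Polyakov long-range order; by McBryan–Spencer the decay is
at least a power law — no area law is asserted). Contrast `z2_finiteTemperatureDeconfinement_dim2`.
[cite: McBryanSpencer1977, main theorem] [cite: BorgsSeiler1983, §II.3 (II.23) (p. 337); §IV (p. 358, the remark on d = 2)] -/
theorem _root_.Literature.MathematicalPhysics.QuantumFieldTheory.u1_polyakovConfinementAtAllCouplings_dim2
    (L₀ : ℕ) [NeZero L₀] : PolyakovConfinementAtAllCouplings 2 L₀ u1Rep := by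
  intro JE JM hJE hJM Ginf hG
  set f : ℝ := (L₀ : ℝ) / (2 * Real.pi * JE) with hf
  have hfpos : 0 < f := by
    have : (0 : ℝ) < L₀ := by exact_mod_cast Nat.pos_of_ne_zero (NeZero.ne L₀)
    positivity
  set C : ℝ := Real.exp (JE * L₀ * (2 * Real.pi * (1 / (2 * Real.pi * JE)) ^ 2 +
      76 * (1 / (2 * Real.pi * JE)) ^ 2 +
      544 * (1 / (2 * Real.pi * JE)) ^ 4 * Real.exp (2 * (1 / (2 * Real.pi * JE)) ^ 2))) *
    (5 : ℝ) ^ f with hC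
  have hbound : ∀ x : Fin 2 → ℤ, |Ginf x| ≤ C * ((Site.supNorm x : ℝ) + 1) ^ (-f) := by
    intro x
    rw [hC, mul_assoc]
    exact u1_abs_thermodynamicLimit_le_rpow_dim2 L₀ hJE hJM.le hG x
  have hdecay : Tendsto (fun x : Fin 2 → ℤ => C * ((Site.supNorm x : ℝ) + 1) ^ (-f)) cofinite (𝓝 0) := by
    have h := ((tendsto_rpow_neg_atTop hfpos).comp tendsto_supNorm_add_one_cofinite).const_mul C
    rw [mul_zero] at h
    exact h
  exact squeeze_zero_norm' (Eventually.of_forall fun x => by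
    rw [Real.norm_eq_abs]; exact hbound x) hdecay

/-- **No finite-temperature Polyakov long-range order for planar `U(1)`**: for every `L₀`, every
`J_E > 0` and `J_M > 0`, the Polyakov loops of `U(1)` lattice gauge theory in `2 + 1` dimensions do
NOT have long-range order. [cite: McBryanSpencer1977, main theorem] [cite: BorgsSeiler1983, §IV (p. 358, the remark on d = 2)] -/
theorem _root_.Literature.MathematicalPhysics.QuantumFieldTheory.u1_not_hasPolyakovLongRangeOrder_dim2
    (L₀ : ℕ) [NeZero L₀] {JE JM : ℝ} (hJE : 0 < JE) (hJM : 0 < JM) :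
    ¬ HasPolyakovLongRangeOrder 2 L₀ u1Rep JE JM := by
  intro h
  obtain ⟨Ginf, hG⟩ := exists_isThermodynamicLimit (d := 2) (L₀ := L₀) u1Rep
    continuous_u1Rep u1Rep_mem_unitaryGroup JE JM
  exact h Ginf hG (u1_polyakovConfinementAtAllCouplings_dim2 L₀ JE JM hJE hJM Ginf hG)

/-- **Temperature-blind Polyakov confinement HOLDS for `U(1)` in `2 + 1` dimensions**: the barrier
file's technique class (i) (`FiniteTemperature.TemperatureBlindPolyakovConfinement`), refuted for
`U(N)`/`SU(N)` in `d ≥ 3` (Borgs–Seiler) and for `ℤ₂` in every `d ≥ 2`, is TRUE for the continuous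
abelian group `U(1)` in `d = 2` — the restriction "three or more space dimensions" of the Borgs–Seiler
deconfinement theorem cannot be lifted for `U(1)`. [cite: McBryanSpencer1977, main theorem]
[cite: BorgsSeiler1983, Abstract; §IV (p. 358, the remark on d = 2)] -/
theorem _root_.Literature.MathematicalPhysics.QuantumFieldTheory.u1_temperatureBlindPolyakovConfinement_dim2 :
    TemperatureBlindPolyakovConfinement 2 u1Rep :=
  fun L₀ _ => u1_polyakovConfinementAtAllCouplings_dim2 L₀

end U1Thermal

/-! ### 6. `U(N)` in `2 + 1` dimensions, every `N ≥ 1`: no Polyakov long-range order at any temperature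

By abelian-centre domination `U(N) ⊇ U(1)` on Borgs–Seiler's lattice
(`unitaryGroup_abs_polyakovCorrelation_le_u1`: `|G_L^{U(N)}(x; J_E, J_M)| ≤ N² G_L^{U(1)}(x; NJ_E, NJ_M)`,
Fröhlich 1979 / Grosse 1988 (4.134)) the planar `U(1)` power law transfers to the fundamental
Polyakov loops of `U(N)`: the continuous centre `U(1) ⊆ U(N)` cannot order in two space dimensions.
HONEST LABEL: fundamental representation of `U(N)` only (the bound is blind to representations
trivial on the centre circle, e.g. the adjoint); nothing is said about `SU(N)` (centre `ℤ_N`,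
discrete), whose planar finite-temperature theory is expected to deconfine like `ℤ_N`
(cf. `z2_finiteTemperatureDeconfinement_dim2` for the abelian `ℤ₂` theory itself). -/

section Unitary

variable {L₀ L : ℕ}

/-- **Power-law bound for the fundamental `U(N)` Polyakov correlation in `2 + 1` dimensions**
(`N ≥ 1`, `L ≥ 3`, `J_E > 0`, `J_M ≥ 0`), uniformly in the volume and in `J_M`:
`|G_L^{U(N)}(x; J_E, J_M)| ≤ N² · K(NJ_E, L₀) · 5^{f_N} · (dist(0,x) + 1)^{−f_N}`, `f_N = L₀/(2πNJ_E)`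
(centre domination `U(N) ⊇ U(1)` composed with the McBryan–Spencer bound at the `N`-fold couplings).
[cite: Grosse1988, §4.2.4 eq. (4.134)] [cite: McBryanSpencer1977, main theorem] -/
theorem unitaryGroup_abs_polyakovCorrelation_le_rpow_dim2 {N : ℕ} [NeZero N] [NeZero L₀] [NeZero L]
    (hL : 3 ≤ L) {JE JM : ℝ} (hJE : 0 < JE) (hJM : 0 ≤ JM) (x : TorusSite 2 L) :
    |polyakovCorrelation (d := 2) (L₀ := L₀) (unitaryFundamentalRep (Fin N) ℂ) JE JM x| ≤
      (N : ℝ) ^ 2 * (Real.exp ((N : ℝ) * JE * L₀ * (2 * Real.pi * (1 / (2 * Real.pi * ((N : ℝ) * JE))) ^ 2 +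
          76 * (1 / (2 * Real.pi * ((N : ℝ) * JE))) ^ 2 +
          544 * (1 / (2 * Real.pi * ((N : ℝ) * JE))) ^ 4 *
            Real.exp (2 * (1 / (2 * Real.pi * ((N : ℝ) * JE))) ^ 2))) *
        ((5 : ℝ) ^ ((L₀ : ℝ) / (2 * Real.pi * ((N : ℝ) * JE))) *
          ((torusDist (0 : TorusSite 2 L) x : ℝ) + 1) ^ (-((L₀ : ℝ) / (2 * Real.pi * ((N : ℝ) * JE)))))) := by
  have hN : (0 : ℝ) < N := by exact_mod_cast Nat.pos_of_ne_zero (NeZero.ne N)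
  have hNJE : 0 < (N : ℝ) * JE := mul_pos hN hJE
  have hNJM : 0 ≤ (N : ℝ) * JM := by positivity
  refine (unitaryGroup_abs_polyakovCorrelation_le_u1 (d := 2) (L₀ := L₀) hJE.le hJM x).trans ?_
  refine mul_le_mul_of_nonneg_left ((le_abs_self _).trans ?_) (by positivity)
  exact U1Thermal.u1_abs_polyakovCorrelation_le_rpow_dim2 (L₀ := L₀) hL hNJE hNJM x

/-- **`U(N)` lattice gauge theory in `2 + 1` dimensions satisfies Polyakov's criterion at EVERY
temporal extent and ALL couplings, for every `N ≥ 1`**: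
`PolyakovConfinementAtAllCouplings 2 L₀ (unitaryFundamentalRep (Fin N) ℂ)` — every thermodynamic
limit of the fundamental Polyakov correlation tends to `0` at spatial infinity (weak sense: no
Polyakov long-range order; no area law asserted). (`U(N) ⊇ U(1)` centre domination,
`unitaryGroup_polyakovConfinementAtAllCouplings_of_u1`, fed with `u1_polyakovConfinementAtAllCouplings_dim2`.)
[cite: Grosse1988, §4.2.4 (text after eq. (4.134))] [cite: McBryanSpencer1977, main theorem]
[cite: BorgsSeiler1983, §II.3 (II.23) (p. 337); §IV (p. 358, the remark on d = 2)] -/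
theorem unitaryGroup_polyakovConfinementAtAllCouplings_dim2 (N L₀ : ℕ) [NeZero N] [NeZero L₀] :
    PolyakovConfinementAtAllCouplings 2 L₀ (unitaryFundamentalRep (Fin N) ℂ) :=
  unitaryGroup_polyakovConfinementAtAllCouplings_of_u1 (u1_polyakovConfinementAtAllCouplings_dim2 L₀)

/-- **No finite-temperature Polyakov long-range order for planar `U(N)`, any `N ≥ 1`**: for every
`L₀`, `J_E > 0`, `J_M > 0`, `¬ HasPolyakovLongRangeOrder 2 L₀ (unitaryFundamentalRep (Fin N) ℂ) J_E J_M`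
— whereas in `d ≥ 3` space dimensions `U(N)` has Polyakov long-range order at large `J_E`
(Borgs–Seiler; the barrier file). [cite: Grosse1988, §4.2.4 eq. (4.134)] [cite: McBryanSpencer1977, main theorem]
[cite: BorgsSeiler1983, Abstract; §IV (p. 358, the remark on d = 2)] -/
theorem unitaryGroup_not_hasPolyakovLongRangeOrder_dim2 (N L₀ : ℕ) [NeZero N] [NeZero L₀]
    {JE JM : ℝ} (hJE : 0 < JE) (hJM : 0 < JM) :
    ¬ HasPolyakovLongRangeOrder 2 L₀ (unitaryFundamentalRep (Fin N) ℂ) JE JM := by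
  intro h
  obtain ⟨Ginf, hG⟩ := exists_isThermodynamicLimit (d := 2) (L₀ := L₀)
    (unitaryFundamentalRep (Fin N) ℂ) (continuous_unitaryFundamentalRep (Fin N) ℂ) (fun g => g.2) JE JM
  exact h Ginf hG (unitaryGroup_polyakovConfinementAtAllCouplings_dim2 N L₀ JE JM hJE hJM Ginf hG)

/-- **Temperature-blind Polyakov confinement HOLDS for `U(N)` in `2 + 1` dimensions, every `N ≥ 1`**:
`TemperatureBlindPolyakovConfinement 2 (unitaryFundamentalRep (Fin N) ℂ)` — the barrier's technique
class (i) for the unitary groups, whose negation in `d ≥ 3` is the Borgs–Seiler deconfinement theorem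
(`not_temperatureBlindPolyakovConfinement_unitary_holds`, `3 ≤ d`), is TRUE in `d = 2`: for `U(N)`
the hypothesis "three or more space dimensions" is necessary and sufficient for finite-temperature
Polyakov long-range order at weak coupling. [cite: Grosse1988, §4.2.4 (text after eq. (4.134))]
[cite: McBryanSpencer1977, main theorem] [cite: BorgsSeiler1983, Abstract; §IV (p. 358, the remark on d = 2)] -/
theorem unitaryGroup_temperatureBlindPolyakovConfinement_dim2 (N : ℕ) [NeZero N] :
    TemperatureBlindPolyakovConfinement 2 (unitaryFundamentalRep (Fin N) ℂ) :=
  fun L₀ _ => unitaryGroup_polyakovConfinementAtAllCouplings_dim2 N L₀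

end Unitary

end Literature.MathematicalPhysics.QuantumFieldTheory

end
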